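import Summits.HodgeConjecture.HodgeConjecture.Theorems.F0P3bCharDistReduction                 -- ★ (p01∕p02's first import: the CM character-identity currency `IsLocSmooth`, `IsLocalDeltaTransfer`, `smoothTrace`)
import Literature.NumberTheory.Rogawski1990.FinExplicitTransferFactorConjRight                    -- ★ `finExplicitCollection`, `finExplicitDelta_conj_left_all ∕ _right_all` (`Δ‴_v`)
import Literature.NumberTheory.Rogawski1990.CharIdentityOnTestFunctionsSignedLemmas               -- ★ `CMNonsplitCharIdentityAtTestSigned`
import Literature.NumberTheory.Automorphic.SmoothCharacterOfCharacter                            -- ★ `SmoothIrrep.ofChar`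
import Literature.NumberTheory.Automorphic.LocalHermitianFormSign                                -- ★ `formSignAt`
import Literature.NumberTheory.Automorphic.UnitaryGroupPrincipalSeriesH                          -- ★ `HLengthTwoLabels`
import Literature.NumberTheory.Automorphic.OrbitalMeasureCanonical                               -- ★ `OrbitalMeasureFamily.IsCanonical` (A1's frame `hm`)
import Literature.NumberTheory.Automorphic.QuadraticHeckeCharacterCM                             -- ★ `quadraticHeckeCharCM` (A1's frame `hμω`)
import Literature.NumberTheory.Automorphic.IrreducibleClassesBoxChar                              -- ★ `IrrClass.boxChar` (p02 T4 `hIND` currency)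
import Literature.NumberTheory.Automorphic.CMPrincipalSeriesHAdmissible                           -- ★ (p03's header) `cmPrincipalSeriesH` admissibility currency
import Literature.NumberTheory.Automorphic.IrreducibleClassesConstituents                        -- ★ (p03's header) `IrrClass.IsConstituentOf`
import Summits.HodgeConjecture.HodgeConjecture.Theorems.F0P3bInducedCharTransferSigned          -- ★ (p03's header) `Representation.IsAdmissible`, `IsFiniteLength`, `Representation.smoothTrace` currency of `h492`
import Summits.HodgeConjecture.HodgeConjecture.Theorems.K2E3SmoothTraceCompositionSeries          -- ★ (p03's header)
import Summits.HodgeConjecture.HodgeConjecture.Cruxes.H413.Lines.R90_S4_HPacketsU2B               -- S4 FILE B (`R90.S4.IsRogPacketH`, A1's frame :92 `hρ`, by name)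
import Literature.NumberTheory.Rogawski1990.SmoothTransferSplitPlaceNamed                   -- ★ `UnitaryGroup.cmSplitTransfer` (L. 4.13.1 (a) named split transfer; ED. 2 socket `_4131b_vanDijkSplit`)
import Summits.HodgeConjecture.HodgeConjecture.Theorems.R90S3Print4131bVanDijkSplitOf           -- ★ p862576 (K2E3-p17, S3-p13): JUNCTION `print_4131b_vanDijkSplit_of` = socket 6 from (VD)(J1)(J2)(J3) (ED. 3 import, S3-R17)
import Summits.HodgeConjecture.HodgeConjecture.Theorems.R90S3VanDijkParabolicIndGLAdmissible      -- ★ p862800 (K2E3-p21): (VD) `GLn.vanDijkTraceParabolicIndGL_admissible_lastBlockLabel_three` (ED. 3 import)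
import Summits.HodgeConjecture.HodgeConjecture.Theorems.R90S3SplitSigmaDictionaryGL3              -- ★ p862908 (K2E3-p17, S3-p15): (J1) `splitSigmaDictionary_GL3` (ED. 3 import)
import Summits.HodgeConjecture.HodgeConjecture.Theorems.R90S3SplitTransportParabolicIndGL3        -- ★ p862646 (S3-p14): (J2) `splitTransport_parabolicIndGL3` (ED. 3 import)
import Summits.HodgeConjecture.HodgeConjecture.Theorems.R90S3FiniteExpansionParabolicIndGL3Holds  -- ★ p862909 (R90-C14-p01, S3-p17′): (J3) `finiteExpansion_parabolicIndGL3`, unconditional (ED. 3 import)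
import Summits.HodgeConjecture.HodgeConjecture.Theorems.R90S3Print492IndPS                      -- ★ p863250 (R90-C14-p01, W5-d): `print_492_indPS` = socket `_492_indPS` (⟸ ★ p863089 W5-a, ★ p862923, ★ p862949 W5-c) (ED. 4 import, S3-R21)
import Summits.HodgeConjecture.HodgeConjecture.Theorems.R90S3Print492Lds                        -- ★ p863049 (K2E3-p17, W5-e): `print_492_lds` = socket `_492_lds` from `h492` + `hTwo` (ED. 4 import, S3-R21)
import Summits.HodgeConjecture.HodgeConjecture.Theorems.R90S3U2LdsTwoOfConstituent              -- ★ p863111 (K2E3-p17, W5-e″): `ldsTwo_of_constituent` adapter over S4-B's socket (TWO) `R90.S4.stub_R90_S4_U2_ldsTwo` (ED. 4 import, S3-R21)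
import HarnessLib

/-!
# R90 · S3 · FILE E — `R90_S3_PrintInputsE`: the PRINTED INPUTS of the S3 hands as named sockets (Rogawski 1990 §13.1 Props. 13.1.3–13.1.4, p. 199)

ED. 3 (RULING S3-R17, dealer R90-C12-plan (g2) 2026-09-04T23:15:04Z; pen R90-C12-typ2 (g3)): print socket 6 `stub_R90_S3_print_4131b_vanDijkSplit` is PAID — its `sorry` is replaced by the ★ junction `print_4131b_vanDijkSplit_of` (p862576) applied to ★ (VD) `GLn.vanDijkTraceParabolicIndGL_admissible_lastBlockLabel_three` (p862800), ★ (J1) `splitSigmaDictionary_GL3` (p862908), ★ (J2) `splitTransport_parabolicIndGL3` (p862646), ★ (J3) `finiteExpansion_parabolicIndGL3` (p862909); +5 imports (Theorems only — no Cruxes∕Theses module in their closure, no cycle); EVERY statement byte-identical to ED. 2 (7b707cde5aa9062e); print sockets 6 → 5 (`_1314`, `_1313d`, `_492_indPS`, `_492_lds`, `_1383_rest` stay `sorry`: S3-R15 off-path dockets ∕ WAVE 5).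
ED. 4 (RULING S3-R21, dealer R90-C12-plan (g2) 2026-09-04T23:49:22Z + order 2026-09-05T00:09:49Z; pen R90-C12-typ2 (g3)): the two Lemma 4.9.2 print sockets are PAID BY NAME — `stub_R90_S3_print_492_indPS` := ★ `print_492_indPS` (p863250) and `stub_R90_S3_print_492_lds` := ★ `print_492_lds` (p863049) ∘ (★ `print_492_indPS`, ★ `ldsTwo_of_constituent` (p863111) ∘ S4-B socket (TWO) `R90.S4.stub_R90_S4_U2_ldsTwo L v hv`) — the latter BY NAME through S4-B's socket (TWO) `stub_R90_S4_U2_ldsTwo` (Lines-B import :14), which S4-B ED. 7–8 closes sorry-free (★ p862982 Keys-2 analytic half ⟹ `_ldsRed` ⟹ `_ldsDecomp` ⟹ `_ldsTwo`), so at this edition `#print axioms` of both plugged sockets is the standard trio (no `sorryAx`) — should S4-B reopen (TWO), `_492_lds` is again «modulo S4-B» by the same name; statements byte-identical (idle frame binders `_`-prefixed as in ED. 3); code-`sorry` 5 → 3 (`_1314`, `_1313d`, `_1383_rest` — the §13.8 GLOBAL payers, not S3-local).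

R90-TF SLAB, section S3; dealer R90-C12-plan (g0) RULING S3-R4 «RESIDUES ARE PRINT SOCKETS IN FILE E» (2026-09-04T15:54:13Z): each WAVE-1 hand's
NAMED residue hypothesis (p01 `hQCM` = Prop. 13.1.4 signed at test functions; p02 `hTS` = Prop. 13.1.3 (d) signed at test functions; later editions:
p02 `hIND` (L. 4.9.2 induced identity, lds-H), p03 (L. 12.7.1∕12.7.3 if not ★), p04 (the ONE global input of §13.8)) becomes ONE socket
`stub_R90_S3_print_<prop>` here — body = the hand's hypothesis COPIED from its ★ head bytes, with the packet-membership premise (`… ∈ ρ →`)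
dropped (print states the identity for every representation of the type) and ∀-closed over A1's frame binders (tree A :55–:89 token for token).
Typist `hodgecm-mathlib-R90-C12-typ1` (g2), pen `stmt-HodgeConjecture-24833` ✓.  Imports ★ + S4 FILE B only (no S3 `Lines` file, no A; R-S3-1∕D-1).  No `def`.

* `stub_R90_S3_print_1314` — Prop. 13.1.4 at test functions, SIGNED by the local form sign `formSignAt` (★ `CMNonsplitCharIdentityAtTestSigned`): for every
  smooth character `Ξ` of `H_v` there is a class `πn` of `G_v` with `Ξ(f^H) = ε_v · (Tr πn(f) + Tr πs(f))`-shape identity as ★ packages it — COPIED from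
  ★ `R90.S3.endoExpansion_exists_of_oneDim`'s `hQCM` (`Theorems/R90S3EndoExpansionOneDim.lean`, p861615, :106–:116).  D ED. 2 pays FILE D's
  `stub_R90_S3_endoExpansion_oneDim … ρ h1 := endoExpansion_exists_of_oneDim … ρ h1 (fun Ξ hΞ _ => stub_R90_S3_print_1314 … Ξ hΞ)`.
* `stub_R90_S3_print_1313d` — Prop. 13.1.3 (d) at test functions, SIGNED, identity only (v1.1): for every class `σ` of `H_v` which is the Steinberg
  partner of a one-dimensional `⟦ℂ_Ξ⟧` in a length-two `JH(i_H(χ₂ ⊠ χ₁))` (★ `HLengthTwoLabels`) there are classes `π2 πs` of `G_v` with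
  `Tr σ(f^H) = ε_v · (Tr π2(f) − Tr πs(f))` for all `Δ‴_v`-matched smooth `(f^H, f)` — COPIED from ★ `R90.S3.endoExpansion_exists_of_steinberg`'s `hTS`
  (`Theorems/R90S3EndoExpansionSteinbergOfStCharTS.lean`, p861644, :109–:126).  D ED. 2: `hTS := fun σ _ χ₂ χ₁ Ξ hΞ hlab => stub_R90_S3_print_1313d … σ χ₂ χ₁ Ξ hΞ hlab`.
* `stub_R90_S3_print_492_indPS` — Lemma 4.9.2 SIGNED + finite length of `i_G(χ̃)` (p03's `h492`, identity `Tr i_H(χ₂ ⊠ χ₁)(f^H) = ε · Tr I(f)` with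
  `I` admissible of finite length, `ε : ℤ` free): body = ★ `R90.S3.endoExpansion_exists_of_indPS`'s `h492` (`Theorems/R90S3EndoExpansionIndPS.lean`,
  d14b99579650a81b, :109–:121) VERBATIM, over A1's COMPLETE binder block :55–:92 (frame + `ρ` + `hρ`; `ρ` stays bound so the body is byte-identical).
  D ED. 2: `h492 := stub_R90_S3_print_492_indPS … ρ hρ`.
* `stub_R90_S3_print_492_lds` — Lemma 4.9.2 for l.d.s.-type `H_v` packets in the VIRTUAL-CHARACTER shape of `_492_indPS` (RULING S3-R8 on AUDIT
  S3#19: premises = ★ p861717's `hIND` telescope :104–:114 verbatim; conclusion `∃ (ε : ℤ) (I admissible of finite length), ∀ matched smooth (f^H, f),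
  Σ_{σ∈ρ} Tr σ(f^H) = ε · Tr I(f)` = ★ p861751's `h492` telescope with LHS `Σ_{σ∈ρ}`; the former two-term shape was print-false on the H-singular
  sub-family, §12.2 pp. 172–173).  KEYED to a Rogawski `H_v`-packet `ρ` (`hρ`).  D ED. 2: `hINDv := stub_R90_S3_print_492_lds … ρ hρ` into hand p09
  `endoExpansion_exists_of_ldsH_virtual`.
* `stub_R90_S3_print_1383_rest` — for a TYPE-T5 packet («the rest»: `hrest` = FILE D's T5 binder verbatim): THE (13.8.3) character expansion of
  `Σ_{σ∈ρ} Tr σ ∘ (f ↦ f^H)` at `v` EXISTS as a countable absolutely-summable `ℤ`-expansion `Σ_{π∈X} a(π) Tr π(f)` AND is finitely supported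
  (L. 12.7.2 ∕ 13.1.3 (c) ∕ Thm 13.1.1 (2)) — form (β) «threaded» of AUDIT S3#17 (print-faithful as typed; the universal form (α) would over-reach
  print without a unitarity law): body = ★ p04's `hEfin` (`Theorems/R90S3EndoExpansionOfFiniteCountableExpansion.lean` 0dce342f88995825 :83–:93)
  VERBATIM over A1 :55–:92 + `(hrest : T5)`.  D ED. 2: `stub_…_rest … ρ hρ hrest := endoExpansion_exists_of_finite_countableExpansion … ρ (stub_R90_S3_print_1383_rest … ρ hρ hrest)`.
* `stub_R90_S3_print_4131b_vanDijkSplit` (ED. 2) — «van Dijk for the NAMED split transfer, summed over the packet» at a place `v` SPLIT in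
  `E` (`hs`): for every `w ∣ v` with `c • w ≠ w` there is a finitely supported `c : Irr(G′_v) →₀ ℤ` with `Σ_{σ∈ρ} Tr σ(cmSplitTransfer … f) = Σ_π c(π) Tr π(f)`
  for all smooth `f` [§4.13 Lemma 4.13.1 (b); §13.8 p. 217 (∗)]: body = ★ `R90.S3.endoExpansion_exists_split_of_stable_of_vanDijk`'s `hVD`
  (`Theorems/R90S3EndoExpansionSplit.lean`, K2E3-p36) VERBATIM over A1's frame with `hv` ↦ `hs` + `(ρ) (hρ)`.  A ED. 3 pays A's split socket
  `:= endoExpansion_exists_split_of_stable_of_vanDijk … (hS := stub_R90_S4_H_stable …) (hVD := stub_R90_S3_print_4131b_vanDijkSplit …)` (up to C's `Iff.rfl` fold).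
Index edges (docstring only, never imported — L5): the CLOSED AGG sockets `F0U3LettersRung1.stub_QCMTS` ∕ `stub_StCharTS` carry the same two
ED. 2 (typ1 (g2)): + socket 6 `stub_R90_S3_print_4131b_vanDijkSplit` (split-place (VD) input for A's split socket ∕ ★ (R-ii)); sockets 1–5 byte-frozen from
ED. 1 c81df219922e.
identities for the inner form and the characters of record.  HONEST LABEL: this file proves nothing; it NAMES six printed inputs as sockets (one per FILE D type-socket + the split-place (VD) input, ED. 2);
HC_CM is proved only modulo the 7 printed citations (2 remaining named inputs: hLiu418 = stmt-HodgeConjecture-24832, h413 = stmt-HodgeConjecture-24833)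
until rung 0 closes; REL ≠ ★ ≠ BUILT.
-/

set_option autoImplicit false
set_option linter.dupNamespace false

namespace Summit.HodgeConjecture.HodgeConjecture.R90.S3

open MeasureTheory IsDedekindDomain NumberField
open Literature.NumberTheory Literature.NumberTheory.Automorphic Literature.NumberTheory.Automorphic.UnitaryGroup
open Literature.NumberTheory.Rogawski1990 Literature.NumberTheory.GaloisRepresentations
open scoped Matrix

variable (L : Type) [Field L] [NumberField L] [IsCMField L] (H' : Matrix (Fin 3) (Fin 3) L)
  (v : HeightOneSpectrum (𝓞 ↥(maximalRealSubfield L)))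

/-- **PRINT SOCKET `stub_R90_S3_print_1314` — Proposition 13.1.4 SIGNED AT TEST FUNCTIONS** («`χ_ξ(f^H) = Σ_{π ∈ Π(ξ)} χ_π(f)`, `Π(ξ) = {πⁿ(ξ), πˢ(ξ)}`,
for one-dimensional `ξ` of `H`; here for every smooth character `Ξ` of `H_v`, in ★ `CMNonsplitCharIdentityAtTestSigned`'s packaging with the sign
`formSignAt L c H′ v` of the local form): body = ★ p01's `hQCM` (:106–:116) with the premise `⟦ℂ_Ξ⟧ ∈ ρ →` dropped, over A1's frame (tree A :55–:89
verbatim).  Why it might fail: it is the printed proposition, proved in print by the global comparison of §13.8 (and for the CM characters of record by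
the CLOSED AGG lineage `stub_QCMTS`, not importable); as a LOCAL statement at arbitrary unitary `H′` with `Δ‴_v` of record it is exactly print's claim —
false only if the sign∕measure conventions of record (`formSignAt`, canonical `mH`, `mG`) disagree with print's at some `v`.
[cite: Rogawski1990, §13.1 Prop. 13.1.4 p. 199; Thm. 13.1.1 (3) p. 198; §12.2 p. 174; §13.8 pp. 212–218] -/
theorem stub_R90_S3_print_1314
    (hH' : (H'.map (cmConjRingHom L))ᵀ = H') (hH'd : IsUnit H'.det)
    (μ : HeckeCharacter L) (hμu : μ.IsUnitary)
    (hμω : ∀ x : Literature.NumberTheory.GaloisRepresentations.ideleGroup ↥(maximalRealSubfield L),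
      μ (AdeleRing.ideleBaseChange (↥(maximalRealSubfield L)) L x) = quadraticHeckeCharCM L x)
    (hv : ∀ w : UnitaryGroup.PlacesOver L v, IsCMField.complexConj L • w.1 = w.1)
    [MeasurableSpace ((UnitaryGroup.cmDatum L 3 H').Local v)] [BorelSpace ((UnitaryGroup.cmDatum L 3 H').Local v)]
    [MeasurableSpace ((UnitaryGroup.cmDatum L 2 (Matrix.of fun i j : Fin 2 => if i.val + j.val + 1 = 2 then (1 : L) else 0)).Local v ×
      (UnitaryGroup.cmDatum L 1 (Matrix.of fun i j : Fin 1 => if i.val + j.val + 1 = 1 then (1 : L) else 0)).Local v)]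
    [BorelSpace ((UnitaryGroup.cmDatum L 2 (Matrix.of fun i j : Fin 2 => if i.val + j.val + 1 = 2 then (1 : L) else 0)).Local v ×
      (UnitaryGroup.cmDatum L 1 (Matrix.of fun i j : Fin 1 => if i.val + j.val + 1 = 1 then (1 : L) else 0)).Local v)]
    [∀ a : ((UnitaryGroup.cmDatum L 2 (Matrix.of fun i j : Fin 2 => if i.val + j.val + 1 = 2 then (1 : L) else 0)).Local v ×
      (UnitaryGroup.cmDatum L 1 (Matrix.of fun i j : Fin 1 => if i.val + j.val + 1 = 1 then (1 : L) else 0)).Local v),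
      MeasurableSpace (((UnitaryGroup.cmDatum L 2 (Matrix.of fun i j : Fin 2 => if i.val + j.val + 1 = 2 then (1 : L) else 0)).Local v ×
      (UnitaryGroup.cmDatum L 1 (Matrix.of fun i j : Fin 1 => if i.val + j.val + 1 = 1 then (1 : L) else 0)).Local v) ⧸
        Subgroup.centralizer ({a} : Set ((UnitaryGroup.cmDatum L 2 (Matrix.of fun i j : Fin 2 => if i.val + j.val + 1 = 2 then (1 : L) else 0)).Local v ×
      (UnitaryGroup.cmDatum L 1 (Matrix.of fun i j : Fin 1 => if i.val + j.val + 1 = 1 then (1 : L) else 0)).Local v)))]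
    [∀ a : ((UnitaryGroup.cmDatum L 2 (Matrix.of fun i j : Fin 2 => if i.val + j.val + 1 = 2 then (1 : L) else 0)).Local v ×
      (UnitaryGroup.cmDatum L 1 (Matrix.of fun i j : Fin 1 => if i.val + j.val + 1 = 1 then (1 : L) else 0)).Local v),
      BorelSpace (((UnitaryGroup.cmDatum L 2 (Matrix.of fun i j : Fin 2 => if i.val + j.val + 1 = 2 then (1 : L) else 0)).Local v ×
      (UnitaryGroup.cmDatum L 1 (Matrix.of fun i j : Fin 1 => if i.val + j.val + 1 = 1 then (1 : L) else 0)).Local v) ⧸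
        Subgroup.centralizer ({a} : Set ((UnitaryGroup.cmDatum L 2 (Matrix.of fun i j : Fin 2 => if i.val + j.val + 1 = 2 then (1 : L) else 0)).Local v ×
      (UnitaryGroup.cmDatum L 1 (Matrix.of fun i j : Fin 1 => if i.val + j.val + 1 = 1 then (1 : L) else 0)).Local v)))]
    [∀ γ : ((UnitaryGroup.cmDatum L 3 H').Local v), MeasurableSpace (((UnitaryGroup.cmDatum L 3 H').Local v) ⧸ Subgroup.centralizer ({γ} : Set ((UnitaryGroup.cmDatum L 3 H').Local v)))]
    [∀ γ : ((UnitaryGroup.cmDatum L 3 H').Local v), BorelSpace (((UnitaryGroup.cmDatum L 3 H').Local v) ⧸ Subgroup.centralizer ({γ} : Set ((UnitaryGroup.cmDatum L 3 H').Local v)))]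
    (νG : Measure ((UnitaryGroup.cmDatum L 3 H').Local v)) [νG.IsHaarMeasure] [νG.IsMulRightInvariant]
    (νH : Measure ((UnitaryGroup.cmDatum L 2 (Matrix.of fun i j : Fin 2 => if i.val + j.val + 1 = 2 then (1 : L) else 0)).Local v ×
      (UnitaryGroup.cmDatum L 1 (Matrix.of fun i j : Fin 1 => if i.val + j.val + 1 = 1 then (1 : L) else 0)).Local v))
    [νH.IsHaarMeasure] [νH.IsMulRightInvariant]
    (mH : OrbitalMeasureFamily ((UnitaryGroup.cmDatum L 2 (Matrix.of fun i j : Fin 2 => if i.val + j.val + 1 = 2 then (1 : L) else 0)).Local v ×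
      (UnitaryGroup.cmDatum L 1 (Matrix.of fun i j : Fin 1 => if i.val + j.val + 1 = 1 then (1 : L) else 0)).Local v))
    (mG : OrbitalMeasureFamily ((UnitaryGroup.cmDatum L 3 H').Local v))
    (hm : mH.IsCanonical (IsLocalGRegular L v) νH ∧
      mG.IsCanonical (fun γ => IsRegularElt (γ.val : GL (Fin 3) (UnitaryGroup.LocalRing L v))) νG)
    (hT : IsLocalDeltaTransferExists L H' v (finExplicitCollection L H' μ (finExplicitDelta_conj_left_all L H' μ) (finExplicitDelta_conj_right_all L H' μ) v) mH mG
      IsLocSmooth IsLocSmooth) :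
    ∀ (Ξ : (UnitaryGroup.cmDatum L 2 (Matrix.of fun i j : Fin 2 => if i.val + j.val + 1 = 2 then (1 : L) else 0)).Local v ×
        (UnitaryGroup.cmDatum L 1 (Matrix.of fun i j : Fin 1 => if i.val + j.val + 1 = 1 then (1 : L) else 0)).Local v →* ℂˣ)
        (hΞ : IsOpen ((Ξ.ker : Subgroup ((UnitaryGroup.cmDatum L 2 (Matrix.of fun i j : Fin 2 => if i.val + j.val + 1 = 2 then (1 : L) else 0)).Local v ×
        (UnitaryGroup.cmDatum L 1 (Matrix.of fun i j : Fin 1 => if i.val + j.val + 1 = 1 then (1 : L) else 0)).Local v)) :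
          Set ((UnitaryGroup.cmDatum L 2 (Matrix.of fun i j : Fin 2 => if i.val + j.val + 1 = 2 then (1 : L) else 0)).Local v ×
        (UnitaryGroup.cmDatum L 1 (Matrix.of fun i j : Fin 1 => if i.val + j.val + 1 = 1 then (1 : L) else 0)).Local v))),
          ∃ πn : IrrClass ((UnitaryGroup.cmDatum L 3 H').Local v),
            CMNonsplitCharIdentityAtTestSigned L v H'
              (finExplicitCollection L H' μ (finExplicitDelta_conj_left_all L H' μ) (finExplicitDelta_conj_right_all L H' μ) v)
              mH mG νG νH Ξ ((formSignAt L (IsCMField.complexConj L) H' v : ℤ) : ℂ) πn := by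
  sorry

/-- **PRINT SOCKET `stub_R90_S3_print_1313d` — Proposition 13.1.3 (d) SIGNED AT TEST FUNCTIONS, identity only** («`ξ_H(St_H(ξ)) = {π²(ξ), πˢ(ξ)}`,
`⟨ρ, π²(ξ)⟩ = 1`, `⟨ρ, πˢ(ξ)⟩ = −1`»: for every class `σ` of `H_v` that is the Steinberg partner of a one-dimensional `⟦ℂ_Ξ⟧` in a length-two
`JH(i_H(χ₂ ⊠ χ₁))` (★ `HLengthTwoLabels`), classes `π2 πs` of `G_v` with `Tr σ(f^H) = ε_v · (Tr π2(f) − Tr πs(f))` for all `Δ‴_v`-matched smooth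
`(f^H, f)`): body = ★ p02's `hTS` (:109–:126) with `∀ σ ∈ ρ` replaced by `∀ σ`, over A1's frame (tree A :55–:89 verbatim).  Why it might fail: the
Steinberg character transfer signed at test functions is open print locally (N-1273S lineage; CLOSED AGG `stub_StCharTS` for the inner form, not
importable); proved in print globally (§13.8) together with L. 12.7.3; false only through the sign∕measure conventions of record.
[cite: Rogawski1990, §13.1 Prop. 13.1.3 (d) p. 199; §12.7 Lemma 12.7.3 p. 195; §12.1 pp. 171–172; §13.8 pp. 212–218] -/
theorem stub_R90_S3_print_1313d
    (hH' : (H'.map (cmConjRingHom L))ᵀ = H') (hH'd : IsUnit H'.det)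
    (μ : HeckeCharacter L) (hμu : μ.IsUnitary)
    (hμω : ∀ x : Literature.NumberTheory.GaloisRepresentations.ideleGroup ↥(maximalRealSubfield L),
      μ (AdeleRing.ideleBaseChange (↥(maximalRealSubfield L)) L x) = quadraticHeckeCharCM L x)
    (hv : ∀ w : UnitaryGroup.PlacesOver L v, IsCMField.complexConj L • w.1 = w.1)
    [MeasurableSpace ((UnitaryGroup.cmDatum L 3 H').Local v)] [BorelSpace ((UnitaryGroup.cmDatum L 3 H').Local v)]
    [MeasurableSpace ((UnitaryGroup.cmDatum L 2 (Matrix.of fun i j : Fin 2 => if i.val + j.val + 1 = 2 then (1 : L) else 0)).Local v ×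
      (UnitaryGroup.cmDatum L 1 (Matrix.of fun i j : Fin 1 => if i.val + j.val + 1 = 1 then (1 : L) else 0)).Local v)]
    [BorelSpace ((UnitaryGroup.cmDatum L 2 (Matrix.of fun i j : Fin 2 => if i.val + j.val + 1 = 2 then (1 : L) else 0)).Local v ×
      (UnitaryGroup.cmDatum L 1 (Matrix.of fun i j : Fin 1 => if i.val + j.val + 1 = 1 then (1 : L) else 0)).Local v)]
    [∀ a : ((UnitaryGroup.cmDatum L 2 (Matrix.of fun i j : Fin 2 => if i.val + j.val + 1 = 2 then (1 : L) else 0)).Local v ×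
      (UnitaryGroup.cmDatum L 1 (Matrix.of fun i j : Fin 1 => if i.val + j.val + 1 = 1 then (1 : L) else 0)).Local v),
      MeasurableSpace (((UnitaryGroup.cmDatum L 2 (Matrix.of fun i j : Fin 2 => if i.val + j.val + 1 = 2 then (1 : L) else 0)).Local v ×
      (UnitaryGroup.cmDatum L 1 (Matrix.of fun i j : Fin 1 => if i.val + j.val + 1 = 1 then (1 : L) else 0)).Local v) ⧸
        Subgroup.centralizer ({a} : Set ((UnitaryGroup.cmDatum L 2 (Matrix.of fun i j : Fin 2 => if i.val + j.val + 1 = 2 then (1 : L) else 0)).Local v ×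
      (UnitaryGroup.cmDatum L 1 (Matrix.of fun i j : Fin 1 => if i.val + j.val + 1 = 1 then (1 : L) else 0)).Local v)))]
    [∀ a : ((UnitaryGroup.cmDatum L 2 (Matrix.of fun i j : Fin 2 => if i.val + j.val + 1 = 2 then (1 : L) else 0)).Local v ×
      (UnitaryGroup.cmDatum L 1 (Matrix.of fun i j : Fin 1 => if i.val + j.val + 1 = 1 then (1 : L) else 0)).Local v),
      BorelSpace (((UnitaryGroup.cmDatum L 2 (Matrix.of fun i j : Fin 2 => if i.val + j.val + 1 = 2 then (1 : L) else 0)).Local v ×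
      (UnitaryGroup.cmDatum L 1 (Matrix.of fun i j : Fin 1 => if i.val + j.val + 1 = 1 then (1 : L) else 0)).Local v) ⧸
        Subgroup.centralizer ({a} : Set ((UnitaryGroup.cmDatum L 2 (Matrix.of fun i j : Fin 2 => if i.val + j.val + 1 = 2 then (1 : L) else 0)).Local v ×
      (UnitaryGroup.cmDatum L 1 (Matrix.of fun i j : Fin 1 => if i.val + j.val + 1 = 1 then (1 : L) else 0)).Local v)))]
    [∀ γ : ((UnitaryGroup.cmDatum L 3 H').Local v), MeasurableSpace (((UnitaryGroup.cmDatum L 3 H').Local v) ⧸ Subgroup.centralizer ({γ} : Set ((UnitaryGroup.cmDatum L 3 H').Local v)))]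
    [∀ γ : ((UnitaryGroup.cmDatum L 3 H').Local v), BorelSpace (((UnitaryGroup.cmDatum L 3 H').Local v) ⧸ Subgroup.centralizer ({γ} : Set ((UnitaryGroup.cmDatum L 3 H').Local v)))]
    (νG : Measure ((UnitaryGroup.cmDatum L 3 H').Local v)) [νG.IsHaarMeasure] [νG.IsMulRightInvariant]
    (νH : Measure ((UnitaryGroup.cmDatum L 2 (Matrix.of fun i j : Fin 2 => if i.val + j.val + 1 = 2 then (1 : L) else 0)).Local v ×
      (UnitaryGroup.cmDatum L 1 (Matrix.of fun i j : Fin 1 => if i.val + j.val + 1 = 1 then (1 : L) else 0)).Local v))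
    [νH.IsHaarMeasure] [νH.IsMulRightInvariant]
    (mH : OrbitalMeasureFamily ((UnitaryGroup.cmDatum L 2 (Matrix.of fun i j : Fin 2 => if i.val + j.val + 1 = 2 then (1 : L) else 0)).Local v ×
      (UnitaryGroup.cmDatum L 1 (Matrix.of fun i j : Fin 1 => if i.val + j.val + 1 = 1 then (1 : L) else 0)).Local v))
    (mG : OrbitalMeasureFamily ((UnitaryGroup.cmDatum L 3 H').Local v))
    (hm : mH.IsCanonical (IsLocalGRegular L v) νH ∧
      mG.IsCanonical (fun γ => IsRegularElt (γ.val : GL (Fin 3) (UnitaryGroup.LocalRing L v))) νG)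
    (hT : IsLocalDeltaTransferExists L H' v (finExplicitCollection L H' μ (finExplicitDelta_conj_left_all L H' μ) (finExplicitDelta_conj_right_all L H' μ) v) mH mG
      IsLocSmooth IsLocSmooth) :
    ∀ (σ : IrrClass ((UnitaryGroup.cmDatum L 2 (Matrix.of fun i j : Fin 2 => if i.val + j.val + 1 = 2 then (1 : L) else 0)).Local v ×
      (UnitaryGroup.cmDatum L 1 (Matrix.of fun i j : Fin 1 => if i.val + j.val + 1 = 1 then (1 : L) else 0)).Local v))
        (χ₂ : ↥(torusU (conjLocal L (IsCMField.complexConj L) v) (cmLocalForm L 2 v)) →* ℂˣ)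
        (χ₁ : (UnitaryGroup.cmDatum L 1 (Matrix.of fun i j : Fin 1 => if i.val + j.val + 1 = 1 then (1 : L) else 0)).Local v →* ℂˣ)
        (Ξ : (UnitaryGroup.cmDatum L 2 (Matrix.of fun i j : Fin 2 => if i.val + j.val + 1 = 2 then (1 : L) else 0)).Local v ×
        (UnitaryGroup.cmDatum L 1 (Matrix.of fun i j : Fin 1 => if i.val + j.val + 1 = 1 then (1 : L) else 0)).Local v →* ℂˣ)
        (hΞ : IsOpen ((Ξ.ker : Subgroup ((UnitaryGroup.cmDatum L 2 (Matrix.of fun i j : Fin 2 => if i.val + j.val + 1 = 2 then (1 : L) else 0)).Local v ×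
        (UnitaryGroup.cmDatum L 1 (Matrix.of fun i j : Fin 1 => if i.val + j.val + 1 = 1 then (1 : L) else 0)).Local v)) :
          Set ((UnitaryGroup.cmDatum L 2 (Matrix.of fun i j : Fin 2 => if i.val + j.val + 1 = 2 then (1 : L) else 0)).Local v ×
        (UnitaryGroup.cmDatum L 1 (Matrix.of fun i j : Fin 1 => if i.val + j.val + 1 = 1 then (1 : L) else 0)).Local v))),
        HLengthTwoLabels L v χ₂ χ₁ (IrrClass.mk (SmoothIrrep.ofChar Ξ hΞ)) σ →
          ∃ π2 πs : IrrClass ((UnitaryGroup.cmDatum L 3 H').Local v),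
            ∀ (fH : (UnitaryGroup.cmDatum L 2 (Matrix.of fun i j : Fin 2 => if i.val + j.val + 1 = 2 then (1 : L) else 0)).Local v ×
        (UnitaryGroup.cmDatum L 1 (Matrix.of fun i j : Fin 1 => if i.val + j.val + 1 = 1 then (1 : L) else 0)).Local v → ℂ)
              (f : (UnitaryGroup.cmDatum L 3 H').Local v → ℂ),
              IsLocSmooth fH → IsLocSmooth f →
                IsLocalDeltaTransfer L H' v
                  (finExplicitCollection L H' μ (finExplicitDelta_conj_left_all L H' μ) (finExplicitDelta_conj_right_all L H' μ) v) mH mG fH f →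
                σ.smoothTrace νH fH =
                  ((formSignAt L (IsCMField.complexConj L) H' v : ℤ) : ℂ) * (π2.smoothTrace νG f - πs.smoothTrace νG f) := by
  sorry

/-- **PRINT SOCKET `stub_R90_S3_print_492_indPS` — Lemma 4.9.2 SIGNED (transfer commutes with parabolic induction) + finite length of `i_G(χ̃)`**, in hand
p03's packaging: for every pair `(χ₂, χ₁)` (`χ₁` smooth) whose `i_H(χ₂ ⊠ χ₁) = cmPrincipalSeriesH L v χ₂ χ₁` has a constituent in the packet `ρ` (so
`i_H ≠ 0` and `χ₂` is continuous), there are `ε : ℤ` and an ADMISSIBLE FINITE-LENGTH representation `I` of `G_v` (print: `I = i_G(χ̃)`, `ε = ±1`) with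
`Tr i_H(χ₂ ⊠ χ₁)(f^H) = ε · Tr I(f)` for all `Δ‴_v`-matched smooth `(f^H, f)`: body = ★ p03's `h492` (tree `Theorems/R90S3EndoExpansionIndPS.lean`
:109–:121) VERBATIM over A1 :55–:92 verbatim.  Why it might fail: L. 4.9.2 SIGNED is ★ only for the CM torus family at ANISOTROPIC `H′`
(`F0P3bInducedCharTransferSigned.inducedCharTransferSigned`); general `(χ₂, χ₁)` and isotropic `H′` are print (van Dijk both sides, Jacobian (4.9.4));
finite length of `i_G(χ̃)` on `U(3)(L⁺_v)` is standard (Bernstein–Zelevinsky∕Casselman) but ★ only for `GL_n`; false only through the sign∕measure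
conventions of record (`ε` is left free, so not even that).
ED. 4 — PAID (S3-R21): body = ★ `print_492_indPS L H' v hH' hH'd μ hμω hv νG νH mH mG hm ρ` (p863250; PLUG LINE OF RECORD, R90-C14-p01 tie probe `TieProbe_W5d_492indPS`); the idle frame hypotheses take the `_` prefix, binder TYPES and ORDER byte-identical to ED. 3.
[cite: Rogawski1990, §4.9 Lemma 4.9.2 pp. 55–56; §12.1 p. 171; §13.1 Thm. 13.1.1 (2) p. 198, p. 199] [cite: vanDijk1972, Thm. p. 237] -/
theorem stub_R90_S3_print_492_indPS
    (hH' : (H'.map (cmConjRingHom L))ᵀ = H') (hH'd : IsUnit H'.det)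
    (μ : HeckeCharacter L) (_hμu : μ.IsUnitary)
    (hμω : ∀ x : Literature.NumberTheory.GaloisRepresentations.ideleGroup ↥(maximalRealSubfield L),
      μ (AdeleRing.ideleBaseChange (↥(maximalRealSubfield L)) L x) = quadraticHeckeCharCM L x)
    (hv : ∀ w : UnitaryGroup.PlacesOver L v, IsCMField.complexConj L • w.1 = w.1)
    [MeasurableSpace ((UnitaryGroup.cmDatum L 3 H').Local v)] [BorelSpace ((UnitaryGroup.cmDatum L 3 H').Local v)]
    [MeasurableSpace ((UnitaryGroup.cmDatum L 2 (Matrix.of fun i j : Fin 2 => if i.val + j.val + 1 = 2 then (1 : L) else 0)).Local v ×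
      (UnitaryGroup.cmDatum L 1 (Matrix.of fun i j : Fin 1 => if i.val + j.val + 1 = 1 then (1 : L) else 0)).Local v)]
    [BorelSpace ((UnitaryGroup.cmDatum L 2 (Matrix.of fun i j : Fin 2 => if i.val + j.val + 1 = 2 then (1 : L) else 0)).Local v ×
      (UnitaryGroup.cmDatum L 1 (Matrix.of fun i j : Fin 1 => if i.val + j.val + 1 = 1 then (1 : L) else 0)).Local v)]
    [∀ a : ((UnitaryGroup.cmDatum L 2 (Matrix.of fun i j : Fin 2 => if i.val + j.val + 1 = 2 then (1 : L) else 0)).Local v ×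
      (UnitaryGroup.cmDatum L 1 (Matrix.of fun i j : Fin 1 => if i.val + j.val + 1 = 1 then (1 : L) else 0)).Local v),
      MeasurableSpace (((UnitaryGroup.cmDatum L 2 (Matrix.of fun i j : Fin 2 => if i.val + j.val + 1 = 2 then (1 : L) else 0)).Local v ×
      (UnitaryGroup.cmDatum L 1 (Matrix.of fun i j : Fin 1 => if i.val + j.val + 1 = 1 then (1 : L) else 0)).Local v) ⧸
        Subgroup.centralizer ({a} : Set ((UnitaryGroup.cmDatum L 2 (Matrix.of fun i j : Fin 2 => if i.val + j.val + 1 = 2 then (1 : L) else 0)).Local v ×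
      (UnitaryGroup.cmDatum L 1 (Matrix.of fun i j : Fin 1 => if i.val + j.val + 1 = 1 then (1 : L) else 0)).Local v)))]
    [∀ a : ((UnitaryGroup.cmDatum L 2 (Matrix.of fun i j : Fin 2 => if i.val + j.val + 1 = 2 then (1 : L) else 0)).Local v ×
      (UnitaryGroup.cmDatum L 1 (Matrix.of fun i j : Fin 1 => if i.val + j.val + 1 = 1 then (1 : L) else 0)).Local v),
      BorelSpace (((UnitaryGroup.cmDatum L 2 (Matrix.of fun i j : Fin 2 => if i.val + j.val + 1 = 2 then (1 : L) else 0)).Local v ×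
      (UnitaryGroup.cmDatum L 1 (Matrix.of fun i j : Fin 1 => if i.val + j.val + 1 = 1 then (1 : L) else 0)).Local v) ⧸
        Subgroup.centralizer ({a} : Set ((UnitaryGroup.cmDatum L 2 (Matrix.of fun i j : Fin 2 => if i.val + j.val + 1 = 2 then (1 : L) else 0)).Local v ×
      (UnitaryGroup.cmDatum L 1 (Matrix.of fun i j : Fin 1 => if i.val + j.val + 1 = 1 then (1 : L) else 0)).Local v)))]
    [∀ γ : ((UnitaryGroup.cmDatum L 3 H').Local v), MeasurableSpace (((UnitaryGroup.cmDatum L 3 H').Local v) ⧸ Subgroup.centralizer ({γ} : Set ((UnitaryGroup.cmDatum L 3 H').Local v)))]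
    [∀ γ : ((UnitaryGroup.cmDatum L 3 H').Local v), BorelSpace (((UnitaryGroup.cmDatum L 3 H').Local v) ⧸ Subgroup.centralizer ({γ} : Set ((UnitaryGroup.cmDatum L 3 H').Local v)))]
    (νG : Measure ((UnitaryGroup.cmDatum L 3 H').Local v)) [νG.IsHaarMeasure] [νG.IsMulRightInvariant]
    (νH : Measure ((UnitaryGroup.cmDatum L 2 (Matrix.of fun i j : Fin 2 => if i.val + j.val + 1 = 2 then (1 : L) else 0)).Local v ×
      (UnitaryGroup.cmDatum L 1 (Matrix.of fun i j : Fin 1 => if i.val + j.val + 1 = 1 then (1 : L) else 0)).Local v))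
    [νH.IsHaarMeasure] [νH.IsMulRightInvariant]
    (mH : OrbitalMeasureFamily ((UnitaryGroup.cmDatum L 2 (Matrix.of fun i j : Fin 2 => if i.val + j.val + 1 = 2 then (1 : L) else 0)).Local v ×
      (UnitaryGroup.cmDatum L 1 (Matrix.of fun i j : Fin 1 => if i.val + j.val + 1 = 1 then (1 : L) else 0)).Local v))
    (mG : OrbitalMeasureFamily ((UnitaryGroup.cmDatum L 3 H').Local v))
    (hm : mH.IsCanonical (IsLocalGRegular L v) νH ∧
      mG.IsCanonical (fun γ => IsRegularElt (γ.val : GL (Fin 3) (UnitaryGroup.LocalRing L v))) νG)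
    (_hT : IsLocalDeltaTransferExists L H' v (finExplicitCollection L H' μ (finExplicitDelta_conj_left_all L H' μ) (finExplicitDelta_conj_right_all L H' μ) v) mH mG
      IsLocSmooth IsLocSmooth)
    (ρ : Finset (IrrClass ((UnitaryGroup.cmDatum L 2 (Matrix.of fun i j : Fin 2 => if i.val + j.val + 1 = 2 then (1 : L) else 0)).Local v ×
      (UnitaryGroup.cmDatum L 1 (Matrix.of fun i j : Fin 1 => if i.val + j.val + 1 = 1 then (1 : L) else 0)).Local v)))
    (_hρ : Summit.HodgeConjecture.HodgeConjecture.R90.S4.IsRogPacketH L v ρ) :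
    ∀ (χ₂ : ↥(torusU (conjLocal L (IsCMField.complexConj L) v) (cmLocalForm L 2 v)) →* ℂˣ)
        (χ₁ : (UnitaryGroup.cmDatum L 1 (Matrix.of fun i j : Fin 1 => if i.val + j.val + 1 = 1 then (1 : L) else 0)).Local v →* ℂˣ),
        IsOpen ((χ₁.ker : Subgroup ((UnitaryGroup.cmDatum L 1 (Matrix.of fun i j : Fin 1 => if i.val + j.val + 1 = 1 then (1 : L) else 0)).Local v)) : Set ((UnitaryGroup.cmDatum L 1 (Matrix.of fun i j : Fin 1 => if i.val + j.val + 1 = 1 then (1 : L) else 0)).Local v)) →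
        (∃ σ ∈ ρ, σ.IsConstituentOf (cmPrincipalSeriesH L v χ₂ χ₁)) →
        ∃ (ε : ℤ) (W : Type) (_ : AddCommGroup W) (_ : Module ℂ W) (I : Representation ℂ ((UnitaryGroup.cmDatum L 3 H').Local v) W),
          I.IsAdmissible ∧ IsFiniteLength (MonoidAlgebra ℂ ((UnitaryGroup.cmDatum L 3 H').Local v)) I.asModule ∧
          ∀ (fH : (UnitaryGroup.cmDatum L 2 (Matrix.of fun i j : Fin 2 => if i.val + j.val + 1 = 2 then (1 : L) else 0)).Local v ×
              (UnitaryGroup.cmDatum L 1 (Matrix.of fun i j : Fin 1 => if i.val + j.val + 1 = 1 then (1 : L) else 0)).Local v → ℂ)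
            (f : (UnitaryGroup.cmDatum L 3 H').Local v → ℂ),
            IsLocSmooth fH → IsLocSmooth f →
              IsLocalDeltaTransfer L H' v
                (finExplicitCollection L H' μ (finExplicitDelta_conj_left_all L H' μ) (finExplicitDelta_conj_right_all L H' μ) v) mH mG fH f →
              (cmPrincipalSeriesH L v χ₂ χ₁).smoothTrace νH fH = (ε : ℂ) * I.smoothTrace νG f := by
  exact print_492_indPS L H' v hH' hH'd μ hμω hv νG νH mH mG hm ρ

/-- **PRINT SOCKET `stub_R90_S3_print_492_lds` — Lemma 4.9.2 (SIGNED, VIRTUAL-CHARACTER SHAPE) for an l.d.s.-type `H_v` packet (RULING S3-R8 on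
AUDIT S3#19, form F1′ = the `_492_indPS` shape minus the constituent premise).**  Print: `χ₁|_{F^×} = ω_{E∕F}` (§11.1 11.1.1 (c) pp. 161–162: `i(χ₁, χ₂)`
is the multiplicity-free sum of two inequivalent l.d.s. `ρ₁ ⊕ ρ₂`), `ρ = {ρ₁, ρ₂} ⊠ χ = JH(i_H(χ̃))` (§12.1 (6) p. 171), hence
`Σ_{σ∈ρ} Tr σ(f^H) = Tr i_H(χ̃)(f^H) = ε_v · Tr I(f)` with `I = i_G(χ̃μ̃)` ADMISSIBLE OF FINITE LENGTH and `ε_v = κ_v` (L. 4.9.2 pp. 55–56) — stated with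
`∃ (ε : ℤ) (I admissible, finite length)` exactly as `stub_R90_S3_print_492_indPS` (weaker than print ⇒ implied).  WHY THIS SHAPE (AUDIT S3#19's witness,
§12.2 pp. 172–173): on the H-SINGULAR sub-family (`θ = φψ ⊗ ψ ⊗ φψ` with `φ = 1`) `i_G(θ̃)` is IRREDUCIBLE (12.2 cases (1)–(3) fail) so `Π(ρ) = {i_G(θ̃)}`
has ONE member (p. 173 l. 1–2) and the former two-term shape `ε·(Tr πa + Tr πb)` (★ p861717's `hIND`) is print-false there; generically (`φ ≠ 1`,
12.2 case (3)) `JH(I) = {πa, πb}` and the two-term corollary holds.  Binders A1 :55–:92 verbatim + `(ρ) (hρ)`; premises = ★ p861717's `hIND` telescope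
:104–:114 verbatim (`O χ hχ χ₁ χ₂`, `IsQuadraticCharExtension χ₁`, `O` = the constituent classes, `ρ = O ⊠ χ`); conclusion = ★ p861751's `h492`
telescope :113–:121 with LHS `∑ σ ∈ ρ, σ.smoothTrace νH fH`.  KEYED to a Rogawski `H_v`-packet (`hρ`, S4-B `IsRogPacketH`, `not_isRogPacketH_empty`) ON
PURPOSE: `ρ ≠ ∅ ⇒ O ≠ ∅ ⇒` the characters are continuous (the bare ∀-closure over `ρ` would be print-false at a discontinuous `χ₂`: `O = ∅ = ρ` forcing
`ε · Tr I ≡ 0`, still satisfiable with `ε = 0` — harmless, but we keep the keyed form of record).  D ED. 2 pays T4 through hand p09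
`endoExpansion_exists_of_ldsH_virtual … ρ hL (hINDv := stub_R90_S3_print_492_lds … ρ hρ)` (JH-expansion of `I`, p03's ★ machinery).  Why it might fail:
L. 4.9.2 SIGNED at general `(χ₁, χ₂)` and BZ∕Casselman finite length of `i_G` are print, not ★ (★ only the CM family at anisotropic `H′`); false only
through the sign∕measure conventions of record (`formSignAt`-free here: `ε` is existential).
ED. 4 — PAID (S3-R21; via S4-B's (TWO) by name): body = ★ `print_492_lds L H' v μ hv νG νH mH mG ρ (print_492_indPS …) (ldsTwo_of_constituent L v (R90.S4.stub_R90_S4_U2_ldsTwo L v hv))` (★ p863049 ∘ (★ p863250, ★ p863111 ∘ S4 (TWO) socket); PLUG OF RECORD, K2E3-p17 tie probe `TieProbe_W5e` f063a5e0); the only non-★ name in the body is S4-B's socket (TWO) `R90.S4.stub_R90_S4_U2_ldsTwo`, sorry-free in S4-B ED. 7–8 (★ p862982 ⟹ ldsRed ⟹ ldsDecomp ⟹ ldsTwo; `--axioms` trio at this edition); idle frame hypotheses `_`-prefixed, binder TYPES and ORDER byte-identical to ED. 3.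
[cite: Rogawski1990, §4.9 Lemma 4.9.2 pp. 55–56; §11.1 Prop. 11.1.1 (c) pp. 161–162; §12.1 p. 171; §12.2 pp. 172–173; §13.1 Thm. 13.1.1 (2), Prop. 13.1.2 (c) p. 198] -/
theorem stub_R90_S3_print_492_lds
    (hH' : (H'.map (cmConjRingHom L))ᵀ = H') (hH'd : IsUnit H'.det)
    (μ : HeckeCharacter L) (_hμu : μ.IsUnitary)
    (hμω : ∀ x : Literature.NumberTheory.GaloisRepresentations.ideleGroup ↥(maximalRealSubfield L),
      μ (AdeleRing.ideleBaseChange (↥(maximalRealSubfield L)) L x) = quadraticHeckeCharCM L x)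
    (hv : ∀ w : UnitaryGroup.PlacesOver L v, IsCMField.complexConj L • w.1 = w.1)
    [MeasurableSpace ((UnitaryGroup.cmDatum L 3 H').Local v)] [BorelSpace ((UnitaryGroup.cmDatum L 3 H').Local v)]
    [MeasurableSpace ((UnitaryGroup.cmDatum L 2 (Matrix.of fun i j : Fin 2 => if i.val + j.val + 1 = 2 then (1 : L) else 0)).Local v ×
      (UnitaryGroup.cmDatum L 1 (Matrix.of fun i j : Fin 1 => if i.val + j.val + 1 = 1 then (1 : L) else 0)).Local v)]
    [BorelSpace ((UnitaryGroup.cmDatum L 2 (Matrix.of fun i j : Fin 2 => if i.val + j.val + 1 = 2 then (1 : L) else 0)).Local v ×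
      (UnitaryGroup.cmDatum L 1 (Matrix.of fun i j : Fin 1 => if i.val + j.val + 1 = 1 then (1 : L) else 0)).Local v)]
    [∀ a : ((UnitaryGroup.cmDatum L 2 (Matrix.of fun i j : Fin 2 => if i.val + j.val + 1 = 2 then (1 : L) else 0)).Local v ×
      (UnitaryGroup.cmDatum L 1 (Matrix.of fun i j : Fin 1 => if i.val + j.val + 1 = 1 then (1 : L) else 0)).Local v),
      MeasurableSpace (((UnitaryGroup.cmDatum L 2 (Matrix.of fun i j : Fin 2 => if i.val + j.val + 1 = 2 then (1 : L) else 0)).Local v ×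
      (UnitaryGroup.cmDatum L 1 (Matrix.of fun i j : Fin 1 => if i.val + j.val + 1 = 1 then (1 : L) else 0)).Local v) ⧸
        Subgroup.centralizer ({a} : Set ((UnitaryGroup.cmDatum L 2 (Matrix.of fun i j : Fin 2 => if i.val + j.val + 1 = 2 then (1 : L) else 0)).Local v ×
      (UnitaryGroup.cmDatum L 1 (Matrix.of fun i j : Fin 1 => if i.val + j.val + 1 = 1 then (1 : L) else 0)).Local v)))]
    [∀ a : ((UnitaryGroup.cmDatum L 2 (Matrix.of fun i j : Fin 2 => if i.val + j.val + 1 = 2 then (1 : L) else 0)).Local v ×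
      (UnitaryGroup.cmDatum L 1 (Matrix.of fun i j : Fin 1 => if i.val + j.val + 1 = 1 then (1 : L) else 0)).Local v),
      BorelSpace (((UnitaryGroup.cmDatum L 2 (Matrix.of fun i j : Fin 2 => if i.val + j.val + 1 = 2 then (1 : L) else 0)).Local v ×
      (UnitaryGroup.cmDatum L 1 (Matrix.of fun i j : Fin 1 => if i.val + j.val + 1 = 1 then (1 : L) else 0)).Local v) ⧸
        Subgroup.centralizer ({a} : Set ((UnitaryGroup.cmDatum L 2 (Matrix.of fun i j : Fin 2 => if i.val + j.val + 1 = 2 then (1 : L) else 0)).Local v ×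
      (UnitaryGroup.cmDatum L 1 (Matrix.of fun i j : Fin 1 => if i.val + j.val + 1 = 1 then (1 : L) else 0)).Local v)))]
    [∀ γ : ((UnitaryGroup.cmDatum L 3 H').Local v), MeasurableSpace (((UnitaryGroup.cmDatum L 3 H').Local v) ⧸ Subgroup.centralizer ({γ} : Set ((UnitaryGroup.cmDatum L 3 H').Local v)))]
    [∀ γ : ((UnitaryGroup.cmDatum L 3 H').Local v), BorelSpace (((UnitaryGroup.cmDatum L 3 H').Local v) ⧸ Subgroup.centralizer ({γ} : Set ((UnitaryGroup.cmDatum L 3 H').Local v)))]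
    (νG : Measure ((UnitaryGroup.cmDatum L 3 H').Local v)) [νG.IsHaarMeasure] [νG.IsMulRightInvariant]
    (νH : Measure ((UnitaryGroup.cmDatum L 2 (Matrix.of fun i j : Fin 2 => if i.val + j.val + 1 = 2 then (1 : L) else 0)).Local v ×
      (UnitaryGroup.cmDatum L 1 (Matrix.of fun i j : Fin 1 => if i.val + j.val + 1 = 1 then (1 : L) else 0)).Local v))
    [νH.IsHaarMeasure] [νH.IsMulRightInvariant]
    (mH : OrbitalMeasureFamily ((UnitaryGroup.cmDatum L 2 (Matrix.of fun i j : Fin 2 => if i.val + j.val + 1 = 2 then (1 : L) else 0)).Local v ×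
      (UnitaryGroup.cmDatum L 1 (Matrix.of fun i j : Fin 1 => if i.val + j.val + 1 = 1 then (1 : L) else 0)).Local v))
    (mG : OrbitalMeasureFamily ((UnitaryGroup.cmDatum L 3 H').Local v))
    (hm : mH.IsCanonical (IsLocalGRegular L v) νH ∧
      mG.IsCanonical (fun γ => IsRegularElt (γ.val : GL (Fin 3) (UnitaryGroup.LocalRing L v))) νG)
    (_hT : IsLocalDeltaTransferExists L H' v (finExplicitCollection L H' μ (finExplicitDelta_conj_left_all L H' μ) (finExplicitDelta_conj_right_all L H' μ) v) mH mG
      IsLocSmooth IsLocSmooth)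
    (ρ : Finset (IrrClass ((UnitaryGroup.cmDatum L 2 (Matrix.of fun i j : Fin 2 => if i.val + j.val + 1 = 2 then (1 : L) else 0)).Local v ×
      (UnitaryGroup.cmDatum L 1 (Matrix.of fun i j : Fin 1 => if i.val + j.val + 1 = 1 then (1 : L) else 0)).Local v)))
    (_hρ : Summit.HodgeConjecture.HodgeConjecture.R90.S4.IsRogPacketH L v ρ) :
    ∀ (O : Finset (IrrClass ((UnitaryGroup.cmDatum L 2 (Matrix.of fun i j : Fin 2 => if i.val + j.val + 1 = 2 then (1 : L) else 0)).Local v)))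
        (χ : (UnitaryGroup.cmDatum L 1 (Matrix.of fun i j : Fin 1 => if i.val + j.val + 1 = 1 then (1 : L) else 0)).Local v →* ℂˣ)
        (hχ : IsOpen ((χ.ker : Subgroup ((UnitaryGroup.cmDatum L 1 (Matrix.of fun i j : Fin 1 => if i.val + j.val + 1 = 1 then (1 : L) else 0)).Local v)) :
          Set ((UnitaryGroup.cmDatum L 1 (Matrix.of fun i j : Fin 1 => if i.val + j.val + 1 = 1 then (1 : L) else 0)).Local v)))
        (χ₁ : (UnitaryGroup.LocalRing L v)ˣ →* ℂˣ) (χ₂ : ↥(normOneUnits (conjLocal L (IsCMField.complexConj L) v)) →* ℂˣ),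
        IsQuadraticCharExtension (conjLocal L (IsCMField.complexConj L) v) χ₁ →
        (∀ c : IrrClass ((UnitaryGroup.cmDatum L 2 (Matrix.of fun i j : Fin 2 => if i.val + j.val + 1 = 2 then (1 : L) else 0)).Local v), c ∈ O ↔
          c.IsConstituentOf
            (cmPrincipalSeries L 2 v
              (torusCharPair (conjLocal L (IsCMField.complexConj L) v) (cmLocalForm L 2 v) (cmLocalForm_eq_over L 2 v) 0 χ₁ χ₂))) →
        ρ = O.map ⟨IrrClass.boxChar χ hχ, IrrClass.boxChar_injective χ hχ⟩ →
          ∃ (ε : ℤ) (W : Type) (_ : AddCommGroup W) (_ : Module ℂ W) (I : Representation ℂ ((UnitaryGroup.cmDatum L 3 H').Local v) W),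
            I.IsAdmissible ∧ IsFiniteLength (MonoidAlgebra ℂ ((UnitaryGroup.cmDatum L 3 H').Local v)) I.asModule ∧
            ∀ (fH : (UnitaryGroup.cmDatum L 2 (Matrix.of fun i j : Fin 2 => if i.val + j.val + 1 = 2 then (1 : L) else 0)).Local v ×
                (UnitaryGroup.cmDatum L 1 (Matrix.of fun i j : Fin 1 => if i.val + j.val + 1 = 1 then (1 : L) else 0)).Local v → ℂ)
              (f : (UnitaryGroup.cmDatum L 3 H').Local v → ℂ),
              IsLocSmooth fH → IsLocSmooth f →
                IsLocalDeltaTransfer L H' v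
                  (finExplicitCollection L H' μ (finExplicitDelta_conj_left_all L H' μ) (finExplicitDelta_conj_right_all L H' μ) v) mH mG fH f →
                ∑ σ ∈ ρ, σ.smoothTrace νH fH = (ε : ℂ) * I.smoothTrace νG f := by
  exact print_492_lds L H' v μ hv νG νH mH mG ρ (print_492_indPS L H' v hH' hH'd μ hμω hv νG νH mH mG hm ρ)
    (ldsTwo_of_constituent L v (Summit.HodgeConjecture.HodgeConjecture.R90.S4.stub_R90_S4_U2_ldsTwo L v hv))

/-- **PRINT SOCKET `stub_R90_S3_print_1383_rest` — (13.8.3) AT `v` + ITS FINITENESS (L. 12.7.2 (i) ∕ Prop. 13.1.3 (c) ∕ Thm. 13.1.1 (2)), form (β)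
«threaded»** (AUDIT S3#17: print's §12.7∕13.8 engine quantifies over the unitary family (13.8.3) itself — «X a countable set of irreducible unitary
representations … Σ a(π) Tr π(f) absolutely convergent» p. 189; «Card(X) = 2·Card(ρ), a(π) = ±1» p. 191; semi-regular `ρ(θ)`: 13.1.3 (c) p. 199):
for every Rogawski `H_v`-packet `ρ` of TYPE T5 (`hrest` = FILE D's complement binder `¬T1 ∧ ¬T2 ∧ ¬T3 ∧ ¬T4` VERBATIM) there are a countable
`X ⊂ IrrClass G′_v` and `a : IrrClass G′_v → ℤ` with `Σ'_{π∈X} a(π)·Tr π(f) = Σ_{σ∈ρ} Tr σ(f^H)` (absolutely summable) for all `Δ‴_v`-matched smooth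
`(f^H, f)`, and `{π ∈ X | a(π) ≠ 0}` finite: body = ★ p04's `hEfin` (`Theorems/R90S3EndoExpansionOfFiniteCountableExpansion.lean`, 0dce342f88995825,
:83–:93) VERBATIM over A1 :55–:92.  Why it might fail: this IS the deep content of Ch. 13 — (13.8.3) comes from the comparison of STABLE trace
formulas (§13.8 pp. 212–218, globalisation p. 227: embed `ρ_v` in a cuspidal `ρ`), owner S10's E1-engine generalised to Π²-packets (dealer 16:12:57Z
(iv)); locally nothing cheaper is printed; false only if a T5 packet of record (S4-B `IsRogPacketH`: a FULL similitude orbit `⊠ χ₁`) were not an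
L-packet of print (then `Σ_{σ∈ρ} Tr σ` is unstable and has no transfer) — excluded by S4-B's packet sockets (11.1.1).
[cite: Rogawski1990, §13.8 Prop. 13.8.1 p. 212, (13.8.3) pp. 217–218; §12.7 Lemma 12.7.2 p. 191; §13.1 Thm. 13.1.1 (2) p. 198, Prop. 13.1.3 (c) p. 199; §13.2 pp. 200–201] -/
theorem stub_R90_S3_print_1383_rest
    (hH' : (H'.map (cmConjRingHom L))ᵀ = H') (hH'd : IsUnit H'.det)
    (μ : HeckeCharacter L) (hμu : μ.IsUnitary)
    (hμω : ∀ x : Literature.NumberTheory.GaloisRepresentations.ideleGroup ↥(maximalRealSubfield L),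
      μ (AdeleRing.ideleBaseChange (↥(maximalRealSubfield L)) L x) = quadraticHeckeCharCM L x)
    (hv : ∀ w : UnitaryGroup.PlacesOver L v, IsCMField.complexConj L • w.1 = w.1)
    [MeasurableSpace ((UnitaryGroup.cmDatum L 3 H').Local v)] [BorelSpace ((UnitaryGroup.cmDatum L 3 H').Local v)]
    [MeasurableSpace ((UnitaryGroup.cmDatum L 2 (Matrix.of fun i j : Fin 2 => if i.val + j.val + 1 = 2 then (1 : L) else 0)).Local v ×
      (UnitaryGroup.cmDatum L 1 (Matrix.of fun i j : Fin 1 => if i.val + j.val + 1 = 1 then (1 : L) else 0)).Local v)]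
    [BorelSpace ((UnitaryGroup.cmDatum L 2 (Matrix.of fun i j : Fin 2 => if i.val + j.val + 1 = 2 then (1 : L) else 0)).Local v ×
      (UnitaryGroup.cmDatum L 1 (Matrix.of fun i j : Fin 1 => if i.val + j.val + 1 = 1 then (1 : L) else 0)).Local v)]
    [∀ a : ((UnitaryGroup.cmDatum L 2 (Matrix.of fun i j : Fin 2 => if i.val + j.val + 1 = 2 then (1 : L) else 0)).Local v ×
      (UnitaryGroup.cmDatum L 1 (Matrix.of fun i j : Fin 1 => if i.val + j.val + 1 = 1 then (1 : L) else 0)).Local v),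
      MeasurableSpace (((UnitaryGroup.cmDatum L 2 (Matrix.of fun i j : Fin 2 => if i.val + j.val + 1 = 2 then (1 : L) else 0)).Local v ×
      (UnitaryGroup.cmDatum L 1 (Matrix.of fun i j : Fin 1 => if i.val + j.val + 1 = 1 then (1 : L) else 0)).Local v) ⧸
        Subgroup.centralizer ({a} : Set ((UnitaryGroup.cmDatum L 2 (Matrix.of fun i j : Fin 2 => if i.val + j.val + 1 = 2 then (1 : L) else 0)).Local v ×
      (UnitaryGroup.cmDatum L 1 (Matrix.of fun i j : Fin 1 => if i.val + j.val + 1 = 1 then (1 : L) else 0)).Local v)))]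
    [∀ a : ((UnitaryGroup.cmDatum L 2 (Matrix.of fun i j : Fin 2 => if i.val + j.val + 1 = 2 then (1 : L) else 0)).Local v ×
      (UnitaryGroup.cmDatum L 1 (Matrix.of fun i j : Fin 1 => if i.val + j.val + 1 = 1 then (1 : L) else 0)).Local v),
      BorelSpace (((UnitaryGroup.cmDatum L 2 (Matrix.of fun i j : Fin 2 => if i.val + j.val + 1 = 2 then (1 : L) else 0)).Local v ×
      (UnitaryGroup.cmDatum L 1 (Matrix.of fun i j : Fin 1 => if i.val + j.val + 1 = 1 then (1 : L) else 0)).Local v) ⧸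
        Subgroup.centralizer ({a} : Set ((UnitaryGroup.cmDatum L 2 (Matrix.of fun i j : Fin 2 => if i.val + j.val + 1 = 2 then (1 : L) else 0)).Local v ×
      (UnitaryGroup.cmDatum L 1 (Matrix.of fun i j : Fin 1 => if i.val + j.val + 1 = 1 then (1 : L) else 0)).Local v)))]
    [∀ γ : ((UnitaryGroup.cmDatum L 3 H').Local v), MeasurableSpace (((UnitaryGroup.cmDatum L 3 H').Local v) ⧸ Subgroup.centralizer ({γ} : Set ((UnitaryGroup.cmDatum L 3 H').Local v)))]
    [∀ γ : ((UnitaryGroup.cmDatum L 3 H').Local v), BorelSpace (((UnitaryGroup.cmDatum L 3 H').Local v) ⧸ Subgroup.centralizer ({γ} : Set ((UnitaryGroup.cmDatum L 3 H').Local v)))]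
    (νG : Measure ((UnitaryGroup.cmDatum L 3 H').Local v)) [νG.IsHaarMeasure] [νG.IsMulRightInvariant]
    (νH : Measure ((UnitaryGroup.cmDatum L 2 (Matrix.of fun i j : Fin 2 => if i.val + j.val + 1 = 2 then (1 : L) else 0)).Local v ×
      (UnitaryGroup.cmDatum L 1 (Matrix.of fun i j : Fin 1 => if i.val + j.val + 1 = 1 then (1 : L) else 0)).Local v))
    [νH.IsHaarMeasure] [νH.IsMulRightInvariant]
    (mH : OrbitalMeasureFamily ((UnitaryGroup.cmDatum L 2 (Matrix.of fun i j : Fin 2 => if i.val + j.val + 1 = 2 then (1 : L) else 0)).Local v ×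
      (UnitaryGroup.cmDatum L 1 (Matrix.of fun i j : Fin 1 => if i.val + j.val + 1 = 1 then (1 : L) else 0)).Local v))
    (mG : OrbitalMeasureFamily ((UnitaryGroup.cmDatum L 3 H').Local v))
    (hm : mH.IsCanonical (IsLocalGRegular L v) νH ∧
      mG.IsCanonical (fun γ => IsRegularElt (γ.val : GL (Fin 3) (UnitaryGroup.LocalRing L v))) νG)
    (hT : IsLocalDeltaTransferExists L H' v (finExplicitCollection L H' μ (finExplicitDelta_conj_left_all L H' μ) (finExplicitDelta_conj_right_all L H' μ) v) mH mG
      IsLocSmooth IsLocSmooth)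
    (ρ : Finset (IrrClass ((UnitaryGroup.cmDatum L 2 (Matrix.of fun i j : Fin 2 => if i.val + j.val + 1 = 2 then (1 : L) else 0)).Local v ×
      (UnitaryGroup.cmDatum L 1 (Matrix.of fun i j : Fin 1 => if i.val + j.val + 1 = 1 then (1 : L) else 0)).Local v)))
    (hρ : Summit.HodgeConjecture.HodgeConjecture.R90.S4.IsRogPacketH L v ρ)
        (hrest : ¬ (∀ σ ∈ ρ, ∃ (Ξ : (UnitaryGroup.cmDatum L 2 (Matrix.of fun i j : Fin 2 => if i.val + j.val + 1 = 2 then (1 : L) else 0)).Local v ×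
        (UnitaryGroup.cmDatum L 1 (Matrix.of fun i j : Fin 1 => if i.val + j.val + 1 = 1 then (1 : L) else 0)).Local v →* ℂˣ)
        (hΞ : IsOpen ((Ξ.ker : Subgroup ((UnitaryGroup.cmDatum L 2 (Matrix.of fun i j : Fin 2 => if i.val + j.val + 1 = 2 then (1 : L) else 0)).Local v ×
        (UnitaryGroup.cmDatum L 1 (Matrix.of fun i j : Fin 1 => if i.val + j.val + 1 = 1 then (1 : L) else 0)).Local v)) :
          Set ((UnitaryGroup.cmDatum L 2 (Matrix.of fun i j : Fin 2 => if i.val + j.val + 1 = 2 then (1 : L) else 0)).Local v ×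
        (UnitaryGroup.cmDatum L 1 (Matrix.of fun i j : Fin 1 => if i.val + j.val + 1 = 1 then (1 : L) else 0)).Local v))),
        σ = IrrClass.mk (SmoothIrrep.ofChar Ξ hΞ)) ∧
      ¬ (∀ σ ∈ ρ, ∃ (χ₂ : ↥(torusU (conjLocal L (IsCMField.complexConj L) v) (cmLocalForm L 2 v)) →* ℂˣ)
        (χ₁ : (UnitaryGroup.cmDatum L 1 (Matrix.of fun i j : Fin 1 => if i.val + j.val + 1 = 1 then (1 : L) else 0)).Local v →* ℂˣ)
        (Ξ : (UnitaryGroup.cmDatum L 2 (Matrix.of fun i j : Fin 2 => if i.val + j.val + 1 = 2 then (1 : L) else 0)).Local v ×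
        (UnitaryGroup.cmDatum L 1 (Matrix.of fun i j : Fin 1 => if i.val + j.val + 1 = 1 then (1 : L) else 0)).Local v →* ℂˣ)
        (hΞ : IsOpen ((Ξ.ker : Subgroup ((UnitaryGroup.cmDatum L 2 (Matrix.of fun i j : Fin 2 => if i.val + j.val + 1 = 2 then (1 : L) else 0)).Local v ×
        (UnitaryGroup.cmDatum L 1 (Matrix.of fun i j : Fin 1 => if i.val + j.val + 1 = 1 then (1 : L) else 0)).Local v)) :
          Set ((UnitaryGroup.cmDatum L 2 (Matrix.of fun i j : Fin 2 => if i.val + j.val + 1 = 2 then (1 : L) else 0)).Local v ×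
        (UnitaryGroup.cmDatum L 1 (Matrix.of fun i j : Fin 1 => if i.val + j.val + 1 = 1 then (1 : L) else 0)).Local v))),
        HLengthTwoLabels L v χ₂ χ₁ (IrrClass.mk (SmoothIrrep.ofChar Ξ hΞ)) σ) ∧
      ¬ (∀ σ ∈ ρ, ∃ (χ₂ : ↥(torusU (conjLocal L (IsCMField.complexConj L) v) (cmLocalForm L 2 v)) →* ℂˣ)
        (χ₁ : (UnitaryGroup.cmDatum L 1 (Matrix.of fun i j : Fin 1 => if i.val + j.val + 1 = 1 then (1 : L) else 0)).Local v →* ℂˣ),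
        IsOpen ((χ₁.ker : Subgroup ((UnitaryGroup.cmDatum L 1 (Matrix.of fun i j : Fin 1 => if i.val + j.val + 1 = 1 then (1 : L) else 0)).Local v)) : Set ((UnitaryGroup.cmDatum L 1 (Matrix.of fun i j : Fin 1 => if i.val + j.val + 1 = 1 then (1 : L) else 0)).Local v)) ∧
        (cmPrincipalSeriesH L v χ₂ χ₁).IsIrreducible ∧ σ.IsConstituentOf (cmPrincipalSeriesH L v χ₂ χ₁)) ∧
      ¬ (∃ (O : Finset (IrrClass ((UnitaryGroup.cmDatum L 2 (Matrix.of fun i j : Fin 2 => if i.val + j.val + 1 = 2 then (1 : L) else 0)).Local v)))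
        (χ : (UnitaryGroup.cmDatum L 1 (Matrix.of fun i j : Fin 1 => if i.val + j.val + 1 = 1 then (1 : L) else 0)).Local v →* ℂˣ)
        (hχ : IsOpen ((χ.ker : Subgroup ((UnitaryGroup.cmDatum L 1 (Matrix.of fun i j : Fin 1 => if i.val + j.val + 1 = 1 then (1 : L) else 0)).Local v)) :
          Set ((UnitaryGroup.cmDatum L 1 (Matrix.of fun i j : Fin 1 => if i.val + j.val + 1 = 1 then (1 : L) else 0)).Local v)))
        (χ₁ : (UnitaryGroup.LocalRing L v)ˣ →* ℂˣ) (χ₂ : ↥(normOneUnits (conjLocal L (IsCMField.complexConj L) v)) →* ℂˣ),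
        IsQuadraticCharExtension (conjLocal L (IsCMField.complexConj L) v) χ₁ ∧
        (∀ c : IrrClass ((UnitaryGroup.cmDatum L 2 (Matrix.of fun i j : Fin 2 => if i.val + j.val + 1 = 2 then (1 : L) else 0)).Local v), c ∈ O ↔
          c.IsConstituentOf
            (cmPrincipalSeries L 2 v
              (torusCharPair (conjLocal L (IsCMField.complexConj L) v) (cmLocalForm L 2 v) (cmLocalForm_eq_over L 2 v) 0 χ₁ χ₂))) ∧
        ρ = O.map ⟨IrrClass.boxChar χ hχ, IrrClass.boxChar_injective χ hχ⟩)) :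
    ∃ (X : Set (IrrClass ((UnitaryGroup.cmDatum L 3 H').Local v))) (a : IrrClass ((UnitaryGroup.cmDatum L 3 H').Local v) → ℤ),
        X.Countable ∧
        (∀ (fH : (UnitaryGroup.cmDatum L 2 (Matrix.of fun i j : Fin 2 => if i.val + j.val + 1 = 2 then (1 : L) else 0)).Local v ×
        (UnitaryGroup.cmDatum L 1 (Matrix.of fun i j : Fin 1 => if i.val + j.val + 1 = 1 then (1 : L) else 0)).Local v → ℂ)
          (f : (UnitaryGroup.cmDatum L 3 H').Local v → ℂ),
          IsLocSmooth fH → IsLocSmooth f →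
            IsLocalDeltaTransfer L H' v
              (finExplicitCollection L H' μ (finExplicitDelta_conj_left_all L H' μ) (finExplicitDelta_conj_right_all L H' μ) v) mH mG fH f →
            Summable (fun π : X => (a π : ℂ) * (π : IrrClass ((UnitaryGroup.cmDatum L 3 H').Local v)).smoothTrace νG f) ∧
              ∑' π : X, (a π : ℂ) * (π : IrrClass ((UnitaryGroup.cmDatum L 3 H').Local v)).smoothTrace νG f = ∑ σ ∈ ρ, σ.smoothTrace νH fH) ∧
        {π | π ∈ X ∧ a π ≠ 0}.Finite := by
  sorry

/-- **PRINT SOCKET `stub_R90_S3_print_4131b_vanDijkSplit` (ED. 2) — VAN DIJK'S FORMULA FOR THE NAMED SPLIT TRANSFER, summed over the packet** (print: at a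
place `v` of `F` that SPLITS in `E`, `G′_v ≃ GL₃(E_w)`, `H_v ≃ GL₂(E_w) × GL₁(E_w)` is a Levi subgroup and `f ↦ f^H = τ_v · f̄^P` is the (twisted) constant term
along the `(2,1)`-parabolic [§4.13 Lemma 4.13.1 (a) p. 64; §13.8 p. 217 «if `v` splits in `E` … (∗) holds»]; van Dijk's formula [L. 4.13.1 (b)]
`Tr σ(f̄^P) = Tr Ind_P^G(σ)(f)` and Jordan–Hölder additivity of the trace of the finite-length `Ind(σ̃)` give, for every finset `ρ` of classes of `H_v`, a finitely
supported `c : Irr(G′_v) →₀ ℤ` (the JH multiplicities, summed over `σ ∈ ρ`) with `Σ_{σ∈ρ} Tr σ(τ_v · f̄^P) = Σ_π c(π) Tr π(f)` for all `f ∈ C_c^∞(G′_v)`): body = ★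
`R90.S3.endoExpansion_exists_split_of_stable_of_vanDijk`'s hypothesis `hVD` (`Theorems/R90S3EndoExpansionSplit.lean`, K2E3-p36 (R-ii)) VERBATIM, over A1's frame
:55–:92 with the non-split guard `hv` replaced by that theorem's `hs` (`∃ w ∣ v, c • w ≠ w`) + `(ρ) (hρ)` (dealer 16:30:44Z (b)); `hμu`, `hT`, `hρ` are carried by
the frame and not needed for truth (the identity holds for every finset `ρ`).  CONSUMER: A ED. 3 pays A's split socket by
`endoExpansion_exists_split_of_stable_of_vanDijk … (hS := ‹S4-B stub_R90_S4_H_stable›) (hVD := stub_R90_S3_print_4131b_vanDijkSplit …)`.  Why it might fail: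
L. 4.13.1 (b) for VECTOR-valued inducing data on the CM carriers is print, not ★ (★: the scalar case and (a)); as typed the identity is sensitive to the
normalisations inside ★ `UnitaryGroup.cmSplitTransfer … μ νH νG` (transfer factor `τ_v`, the `μ_w`-twist, the quotient measure of the constant term): a
non-integral volume constant would break `c ∈ ℤ` — the bet (K2E3-p36's typing, ★ `isLocalDeltaTransfer_cmSplitTransfer` for CANONICAL families `hm`) is that
the named transfer is normalised exactly as print's `f̄^P`, where the constant is `1`.
ED. 3 — PAID (S3-R17): body = ★ `print_4131b_vanDijkSplit_of L H' v hH' hH'd μ νG νH ‹VD› ‹J1› ‹J2› ‹J3› ρ` with ‹VD› = `fun w W _ _ σ' hσ' => GLn.vanDijkTraceParabolicIndGL_admissible_lastBlockLabel_three (F := w.1.adicCompletion L) W σ' hσ'` (★ p862800), ‹J1› = `splitSigmaDictionary_GL3 L H' v hH' hH'd μ νH νG` (★ p862908), ‹J2› = `splitTransport_parabolicIndGL3 L H' v hH' hH'd νG` (★ p862646), ‹J3› = `finiteExpansion_parabolicIndGL3 L H' v hH' hH'd νG` (★ p862909) — the argument spellings of the tie probes of record (K2E3-p17 `TieProbe_S3p15`,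 audit1 `P18_TieProbe2_f8bb`); the frame hypotheses `hμu hμω hs hm hT hρ` (and the centralizer-quotient instances) are not needed for truth (the identity holds for every finset `ρ`): their six binder NAMES take the `_` prefix (dealer S3-R17 «`hρ` becomes `_hρ` if unused»; Lean's unusedVariables linter), binder TYPES and ORDER byte-identical to ED. 2 — the statement is alpha-identical, positional consumers unchanged.
[cite: Rogawski1990, §4.13 Lemma 4.13.1 (a)(b) pp. 64–66; §13.8 p. 217; §13.1 Thm. 13.1.1 (2) p. 198; §4.3 (4.3.1) p. 43] [cite: vanDijk1972, Thm. 1] -/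
theorem stub_R90_S3_print_4131b_vanDijkSplit
    (hH' : (H'.map (cmConjRingHom L))ᵀ = H') (hH'd : IsUnit H'.det)
    (μ : HeckeCharacter L) (_hμu : μ.IsUnitary)
    (_hμω : ∀ x : Literature.NumberTheory.GaloisRepresentations.ideleGroup ↥(maximalRealSubfield L),
      μ (AdeleRing.ideleBaseChange (↥(maximalRealSubfield L)) L x) = quadraticHeckeCharCM L x)
    (_hs : ∃ w : UnitaryGroup.PlacesOver L v, IsCMField.complexConj L • w.1 ≠ w.1)
    [MeasurableSpace ((UnitaryGroup.cmDatum L 3 H').Local v)] [BorelSpace ((UnitaryGroup.cmDatum L 3 H').Local v)]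
    [MeasurableSpace ((UnitaryGroup.cmDatum L 2 (Matrix.of fun i j : Fin 2 => if i.val + j.val + 1 = 2 then (1 : L) else 0)).Local v ×
      (UnitaryGroup.cmDatum L 1 (Matrix.of fun i j : Fin 1 => if i.val + j.val + 1 = 1 then (1 : L) else 0)).Local v)]
    [BorelSpace ((UnitaryGroup.cmDatum L 2 (Matrix.of fun i j : Fin 2 => if i.val + j.val + 1 = 2 then (1 : L) else 0)).Local v ×
      (UnitaryGroup.cmDatum L 1 (Matrix.of fun i j : Fin 1 => if i.val + j.val + 1 = 1 then (1 : L) else 0)).Local v)]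
    [∀ a : ((UnitaryGroup.cmDatum L 2 (Matrix.of fun i j : Fin 2 => if i.val + j.val + 1 = 2 then (1 : L) else 0)).Local v ×
      (UnitaryGroup.cmDatum L 1 (Matrix.of fun i j : Fin 1 => if i.val + j.val + 1 = 1 then (1 : L) else 0)).Local v),
      MeasurableSpace (((UnitaryGroup.cmDatum L 2 (Matrix.of fun i j : Fin 2 => if i.val + j.val + 1 = 2 then (1 : L) else 0)).Local v ×
      (UnitaryGroup.cmDatum L 1 (Matrix.of fun i j : Fin 1 => if i.val + j.val + 1 = 1 then (1 : L) else 0)).Local v) ⧸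
        Subgroup.centralizer ({a} : Set ((UnitaryGroup.cmDatum L 2 (Matrix.of fun i j : Fin 2 => if i.val + j.val + 1 = 2 then (1 : L) else 0)).Local v ×
      (UnitaryGroup.cmDatum L 1 (Matrix.of fun i j : Fin 1 => if i.val + j.val + 1 = 1 then (1 : L) else 0)).Local v)))]
    [∀ a : ((UnitaryGroup.cmDatum L 2 (Matrix.of fun i j : Fin 2 => if i.val + j.val + 1 = 2 then (1 : L) else 0)).Local v ×
      (UnitaryGroup.cmDatum L 1 (Matrix.of fun i j : Fin 1 => if i.val + j.val + 1 = 1 then (1 : L) else 0)).Local v),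
      BorelSpace (((UnitaryGroup.cmDatum L 2 (Matrix.of fun i j : Fin 2 => if i.val + j.val + 1 = 2 then (1 : L) else 0)).Local v ×
      (UnitaryGroup.cmDatum L 1 (Matrix.of fun i j : Fin 1 => if i.val + j.val + 1 = 1 then (1 : L) else 0)).Local v) ⧸
        Subgroup.centralizer ({a} : Set ((UnitaryGroup.cmDatum L 2 (Matrix.of fun i j : Fin 2 => if i.val + j.val + 1 = 2 then (1 : L) else 0)).Local v ×
      (UnitaryGroup.cmDatum L 1 (Matrix.of fun i j : Fin 1 => if i.val + j.val + 1 = 1 then (1 : L) else 0)).Local v)))]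
    [∀ γ : ((UnitaryGroup.cmDatum L 3 H').Local v), MeasurableSpace (((UnitaryGroup.cmDatum L 3 H').Local v) ⧸ Subgroup.centralizer ({γ} : Set ((UnitaryGroup.cmDatum L 3 H').Local v)))]
    [∀ γ : ((UnitaryGroup.cmDatum L 3 H').Local v), BorelSpace (((UnitaryGroup.cmDatum L 3 H').Local v) ⧸ Subgroup.centralizer ({γ} : Set ((UnitaryGroup.cmDatum L 3 H').Local v)))]
    (νG : Measure ((UnitaryGroup.cmDatum L 3 H').Local v)) [νG.IsHaarMeasure] [νG.IsMulRightInvariant]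
    (νH : Measure ((UnitaryGroup.cmDatum L 2 (Matrix.of fun i j : Fin 2 => if i.val + j.val + 1 = 2 then (1 : L) else 0)).Local v ×
      (UnitaryGroup.cmDatum L 1 (Matrix.of fun i j : Fin 1 => if i.val + j.val + 1 = 1 then (1 : L) else 0)).Local v))
    [νH.IsHaarMeasure] [νH.IsMulRightInvariant]
    (mH : OrbitalMeasureFamily ((UnitaryGroup.cmDatum L 2 (Matrix.of fun i j : Fin 2 => if i.val + j.val + 1 = 2 then (1 : L) else 0)).Local v ×
      (UnitaryGroup.cmDatum L 1 (Matrix.of fun i j : Fin 1 => if i.val + j.val + 1 = 1 then (1 : L) else 0)).Local v))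
    (mG : OrbitalMeasureFamily ((UnitaryGroup.cmDatum L 3 H').Local v))
    (_hm : mH.IsCanonical (IsLocalGRegular L v) νH ∧
      mG.IsCanonical (fun γ => IsRegularElt (γ.val : GL (Fin 3) (UnitaryGroup.LocalRing L v))) νG)
    (_hT : IsLocalDeltaTransferExists L H' v (finExplicitCollection L H' μ (finExplicitDelta_conj_left_all L H' μ) (finExplicitDelta_conj_right_all L H' μ) v) mH mG
      IsLocSmooth IsLocSmooth)
    (ρ : Finset (IrrClass ((UnitaryGroup.cmDatum L 2 (Matrix.of fun i j : Fin 2 => if i.val + j.val + 1 = 2 then (1 : L) else 0)).Local v ×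
      (UnitaryGroup.cmDatum L 1 (Matrix.of fun i j : Fin 1 => if i.val + j.val + 1 = 1 then (1 : L) else 0)).Local v)))
    (_hρ : Summit.HodgeConjecture.HodgeConjecture.R90.S4.IsRogPacketH L v ρ) :
    ∀ (w : UnitaryGroup.PlacesOver L v) (hw : IsCMField.complexConj L • w.1 ≠ w.1),
      ∃ c : IrrClass ((UnitaryGroup.cmDatum L 3 H').Local v) →₀ ℤ,
        ∀ f : (UnitaryGroup.cmDatum L 3 H').Local v → ℂ, IsLocSmooth f →
          ∑ σ ∈ ρ, σ.smoothTrace νH (UnitaryGroup.cmSplitTransfer L H' hH' hH'd v w hw μ νH νG f) =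
            ∑ π ∈ c.support, (c π : ℂ) * π.smoothTrace νG f := by
  exact print_4131b_vanDijkSplit_of L H' v hH' hH'd μ νG νH
    (fun w W _ _ σ' hσ' => GLn.vanDijkTraceParabolicIndGL_admissible_lastBlockLabel_three (F := w.1.adicCompletion L) W σ' hσ')
    (splitSigmaDictionary_GL3 L H' v hH' hH'd μ νH νG)
    (splitTransport_parabolicIndGL3 L H' v hH' hH'd νG)
    (finiteExpansion_parabolicIndGL3 L H' v hH' hH'd νG) ρ

end Summit.HodgeConjecture.HodgeConjecture.R90.S3
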